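import Summits.BirchSwinnertonDyer.BirchSwinnertonDyer.Theorems.SoloBlindRankFourUnconditional
import Literature.NumberTheory.EllipticCurves.KatoRankBoundProofs
import Literature.NumberTheory.EllipticCurves.SupersingularDensityProofs
import Literature.NumberTheory.EllipticCurves.DegreeConjectureAbcPrelims
import Literature.NumberTheory.DiophantineGeometry.LocalReductionMinimalityProofs
import Literature.NumberTheory.DiophantineGeometry.LocalReductionIsIntegralAtProofs

/-!
# SoloBlind — the `p`-adic side of the existential floor `(∃4)` is a theorem granting Kato

`SoloBlindRankFourUnconditional` proved, hypothesis-free, that the curve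
`E4 : y² + xy = x³ − x² − 79x + 289` (Cremona `234446a1`; in Lean the bound variable `W` under
`hW : W = ⟨1, -1, 0, -79, 289⟩`) has `rank E4(ℚ) ≥ 4`, hence that rank-BSD implies the
EXISTENTIAL FLOOR `(∃4)`: some `L(E, s)`, `E/ℚ`, vanishes to order `≥ 4` at `s = 1`
(`bsd_exists_four_le_analyticRank`).  No instance of `ord_{s=1} L(E,s) ≥ 4` — indeed of `≥ 3` for a
curve of even sign — is a theorem for any `E/ℚ`: a third central derivative of an individual
`L`-function has no known algebraic criterion for vanishing.

This file records, in the kernel, that the `p`-ADIC analogue of the floor is NOT open.  Granting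
Kato's rank bound `rank E(ℚ) ≤ ord_{T=0} L_p(E,T)` at odd good ordinary primes (K. Kato, Astérisque
295 (2004), Thm. 18.4, "In particular"; the tree's named fact
`kato_mordellWeilRank_le_order_padicLFunction`, itself reduced in the tree to Kato's divisibility
Thm. 17.4, `kato_divisibility`, by `kato_mordellWeilRank_le_order_padicLFunction_of_kato_divisibility`):

* `E4_isGloballyMinimal` — the equation `[1,-1,0,-79,289]` is a global minimal model
  (`Δ = 468892 = 2²·117223` is free of twelfth powers; Silverman AEC VII.1 Remark 1.1 at every
  prime, via the tree theorems `isMinimalAt_of_lt_valuation_Δ_holds` and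
  `isGloballyMinimal_of_forall_isMinimalAt_int`), so that `IsOrdinaryAt`, `unitRoot` and Kato's
  fact apply to it literally;
* `four_le_order_padicLFunction_E4` — for EVERY odd good ordinary prime `p` of `E4` and its
  newform `f`: `4 ≤ ord_{T=0} L_p(f, α_p, T)` (`α_p = unitRoot E4 p`);
* `exists_gt_goodOrdinary_four_le_order_E4` — such primes exist beyond every bound (the tree's
  PROVED `infinite_goodOrdinaryPrimes_holds`), so the bound is not vacuous;
* `kato_exists_four_le_padicOrder` — the `p`-adic twin of `bsd_exists_four_le_analyticRank`:
  granting Kato 18.4 and modularity (`exists_isNewformOf`), SOME elliptic curve over `ℚ` has a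
  cyclotomic `p`-adic `L`-function vanishing to order `≥ 4` at `T = 0` at some odd good ordinary
  prime — with NO appeal to `BirchSwinnertonDyer`; `…_of_kato_divisibility` is the same over
  Kato's Thm. 17.4;
* `four_le_analyticRank_E4_of_orderTransferAt` — the complex floor `(∃4)` follows from ONE
  instance of one-sided order transfer: if at a single odd good ordinary prime
  `ord_{T=0} L_p(E4,T) ≤ ord_{s=1} L(E4,s)`, then `ord_{s=1} L(E4,s) ≥ 4`.

Reading (the census's wall W2 at its floor).  The two "analytic ranks" of `E4` stand thus:
`ρ_p(E4) = ord_T L_p ≥ 4` at every odd good ordinary `p` is a theorem over Kato (and `≤ 4`,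
hence `= 4`, at `p = 5, 7` by certified modular-symbol computation, outside the kernel), while
`a(E4) = ord_{s=1} L(E4,s) ≥ 4` (equivalently `≥ 3`, the sign being `+1`) is open.  The only
proved bridges between `ord_T L_p` and `ord_s L` are the interpolation formula
`L_p(0) = (1 − α⁻¹)² L(E,1)/Ω` (Mazur–Tate–Teitelbaum), the common parity of the two orders
(the sign of the two functional equations), and in order one Perrin-Riou's `p`-adic Gross–Zagier
formula; together they give the inequality `ord_T L_p ≤ ord_s L` only while `ord_T L_p ≤ 2`
(for `ord_T L_p = 1` at primes admissible for Perrin-Riou, with Gross–Zagier–Kolyvagin), and it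
is open from `ord_T L_p = 3` on (at `3` against `ord_s L = 1` it is the non-vanishing of the
cyclotomic `p`-adic height of the Heegner point).  `four_le_analyticRank_E4_of_orderTransferAt`
shows that this inequality at one prime for this one curve — where `ord_T L_p ≥ 4` — is exactly
what separates the proved `p`-adic floor from the open complex one.

Sources: K. Kato, Astérisque 295 (2004), Thm. 17.4 (p. 273), Thm. 18.4 (p. 281);
B. Mazur, J. Tate, J. Teitelbaum, Invent. Math. 84 (1986), §II.18–19; B. Perrin-Riou, Invent.
Math. 89 (1987); J. H. Silverman, AEC 2nd ed. (2009), VII.1 Remark 1.1, VIII.8;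
J.-P. Serre, Publ. Math. IHÉS 54 (1981), §8 (infinitude of ordinary primes).
No definitions are introduced; every hypothesis is a named Literature fact quoted by name.
-/

set_option linter.dupNamespace false

open scoped MatrixGroups ModularForm
open CongruenceSubgroup IsDedekindDomain Literature.NumberTheory.EllipticCurves
  Literature.NumberTheory.EllipticCurves.ModularForms WeierstrassCurve

namespace Summit.BirchSwinnertonDyer.BirchSwinnertonDyer.Theorems.SoloBlind

variable {W : WeierstrassCurve ℚ}

/-! ### The equation `[1,-1,0,-79,289]` is globally minimal -/

/-- No twelfth power of an integer `q` which is neither zero nor a unit divides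
`468892 = 2² · 117223` (`|q| ≥ 3` gives `q¹² > 468892`; `q = ±2` gives `4096 ∤ 468892`). -/
theorem not_pow_twelve_dvd_Δ_E4 (q : ℤ) (hq0 : q ≠ 0) (hqu : ¬ IsUnit q) :
    ¬ q ^ 12 ∣ (468892 : ℤ) := by
  intro hdvd
  have h2 : 2 ≤ q.natAbs := by
    rcases Nat.lt_or_ge q.natAbs 2 with h | h
    · interval_cases hq : q.natAbs
      · exact absurd (Int.natAbs_eq_zero.mp hq) hq0
      · exact absurd (Int.isUnit_iff_natAbs_eq.mpr hq) hqu
    · exact h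
  have hdvd' : q.natAbs ^ 12 ∣ 468892 := by
    have := Int.natAbs_dvd_natAbs.mpr hdvd
    simpa [Int.natAbs_pow] using this
  have hle : q.natAbs ^ 12 ≤ 468892 := Nat.le_of_dvd (by norm_num) hdvd'
  have hq2 : q.natAbs = 2 := by
    by_contra hne
    have h3 : 3 ≤ q.natAbs := by omega
    have h3' : 3 ^ 12 ≤ q.natAbs ^ 12 := Nat.pow_le_pow_left h3 12
    norm_num at h3'
    omega
  rw [hq2] at hdvd'
  exact absurd hdvd' (by norm_num)

/-- **`E4 = [1,-1,0,-79,289]` is a global minimal Weierstrass equation.**  Its coefficients are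
integers, so it is integral at every prime (`isIntegralAt_iff_valuation_le_one`), and its
discriminant `Δ = 468892 = 2²·117223` (`E4_Δ`) lies in no twelfth power of a nonzero prime ideal
of `ℤ` (`not_pow_twelve_dvd_Δ_E4`), i.e. `ord_p Δ < 12` at every `p`; hence the equation is
minimal at every prime (Silverman, AEC VII.1 Remark 1.1 — the tree theorem
`isMinimalAt_of_lt_valuation_Δ_holds`) and globally minimal
(`isGloballyMinimal_of_forall_isMinimalAt_int`, AEC VIII.8). -/
theorem E4_isGloballyMinimal (hW : W = ⟨1, -1, 0, -79, 289⟩) : W.IsGloballyMinimal := by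
  refine isGloballyMinimal_of_forall_isMinimalAt_int W fun v ↦ ?_
  have hint : W.IsIntegralAt v := by
    rw [isIntegralAt_iff_valuation_le_one]
    subst hW
    refine ⟨by simp, by simp, by simp, ?_, ?_⟩
    · simpa using v.valuation_le_one (K := ℚ) (-79 : ℤ)
    · simpa using v.valuation_le_one (K := ℚ) (289 : ℤ)
  refine isMinimalAt_of_lt_valuation_Δ_holds hint ?_
  rw [E4_Δ hW]
  have hval : v.valuation ℚ (468892 : ℚ) = v.intValuation (468892 : ℤ) := by
    rw [← HeightOneSpectrum.valuation_of_algebraMap (K := ℚ)]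
    norm_num
  rw [hval]
  have h12 : ¬ v.intValuation (468892 : ℤ) ≤ WithZero.exp (-((12 : ℕ) : ℤ)) := by
    rw [HeightOneSpectrum.intValuation_le_pow_iff_mem]
    intro hmem
    set q := Submodule.IsPrincipal.generator v.asIdeal with hq
    have hspan : v.asIdeal = Ideal.span {q} := (Ideal.span_singleton_generator v.asIdeal).symm
    rw [hspan, Ideal.span_singleton_pow, Ideal.mem_span_singleton] at hmem
    have hq0 : q ≠ 0 := by
      intro h
      apply v.ne_bot
      rw [hspan, h, Ideal.span_singleton_eq_bot]
    have hqu : ¬ IsUnit q := by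
      intro h
      apply v.isPrime.ne_top
      rw [hspan]
      exact (Ideal.span_singleton_eq_top).mpr h
    exact not_pow_twelve_dvd_Δ_E4 q hq0 hqu hmem
  push_cast at h12
  exact lt_of_not_ge h12

/-! ### Kato's bound at the rank-four curve -/

/-- **The `p`-adic floor at `E4`, every odd good ordinary prime.**  Granting Kato's rank bound
`rank E(ℚ) ≤ ord_{T=0} L_p(E,T)` (Astérisque 295, Thm. 18.4, the named fact
`kato_mordellWeilRank_le_order_padicLFunction`, quantified over all curves and primes as in its
statement file): for every odd prime `p` at which `E4 = 234446a1` has good ordinary reduction and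
every weight-2 newform `f` with `IsNewformOf E4 f`, the cyclotomic `p`-adic `L`-function
`L_p(f, α_p, T)`, `α_p = unitRoot E4 p`, vanishes to order at least `4` at `T = 0` — because
`rank E4(ℚ) ≥ 4` unconditionally (`four_le_rank_E4`).  The instance `E4_isGloballyMinimal` makes
`IsOrdinaryAt` / `unitRoot` refer to this very equation. -/
theorem four_le_order_padicLFunction_E4
    (hKato : ∀ (W : WeierstrassCurve ℚ) [W.IsElliptic] [W.IsGloballyMinimal] (p : ℕ)
      [Fact p.Prime] {N : ℕ} [NeZero N] {f : CuspForm (Gamma0 N) 2},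
      kato_mordellWeilRank_le_order_padicLFunction W p (f := f))
    (hW : W = ⟨1, -1, 0, -79, 289⟩) (p : ℕ) [Fact p.Prime] (hp : p ≠ 2)
    (hord : haveI := E4_isGloballyMinimal hW; IsOrdinaryAt W p)
    {N : ℕ} [NeZero N] {f : CuspForm (Gamma0 N) 2} (hf : IsNewformOf W f) :
    haveI := E4_isGloballyMinimal hW
    (4 : ℕ∞) ≤ (padicLFunction f (unitRoot W p : ℚ_[p])).order := by
  haveI := E4_isElliptic hW
  haveI := E4_isGloballyMinimal hW
  have h4 : ((4 : ℕ) : ℕ∞) ≤ (W.mordellWeilRank : ℕ∞) := by exact_mod_cast four_le_rank_E4 hW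
  exact h4.trans (hKato W p hp hord hf)

/-- **The bound is not vacuous: good ordinary primes of `E4` beyond every bound.**  For every `n`
there is a prime `p > n` (in particular odd for `n ≥ 2`) of good ordinary reduction for `E4` at
which, granting Kato 18.4, `ord_{T=0} L_p(f, α_p, T) ≥ 4` for every newform `f` of `E4`.  The
supply of primes is the tree's PROVED `infinite_goodOrdinaryPrimes_holds` (elementary; Serre 1981
§8 for the density statement). -/
theorem exists_gt_goodOrdinary_four_le_order_E4
    (hKato : ∀ (W : WeierstrassCurve ℚ) [W.IsElliptic] [W.IsGloballyMinimal] (p : ℕ)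
      [Fact p.Prime] {N : ℕ} [NeZero N] {f : CuspForm (Gamma0 N) 2},
      kato_mordellWeilRank_le_order_padicLFunction W p (f := f))
    (hW : W = ⟨1, -1, 0, -79, 289⟩) (n : ℕ) :
    haveI := E4_isGloballyMinimal hW
    ∃ (p : ℕ) (_ : Fact p.Prime), n < p ∧ IsOrdinaryAt W p ∧
      ∀ {N : ℕ} [NeZero N] (f : CuspForm (Gamma0 N) 2), IsNewformOf W f → p ≠ 2 →
        (4 : ℕ∞) ≤ (padicLFunction f (unitRoot W p : ℚ_[p])).order := by
  haveI := E4_isElliptic hW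
  haveI := E4_isGloballyMinimal hW
  obtain ⟨p, ⟨hp, hgood, hnd⟩, hnp⟩ := (infinite_goodOrdinaryPrimes_holds W).exists_gt n
  exact ⟨p, hp, hnp, ⟨hgood, hnd⟩, fun f hf hp2 =>
    four_le_order_padicLFunction_E4 hKato hW p hp2 ⟨hgood, hnd⟩ hf⟩

/-- **`(∃4)` on the `p`-adic side is a theorem granting Kato 18.4 and modularity.**  There is an
elliptic curve over `ℚ` (namely `E4 = 234446a1`, globally minimal equation), a weight-2 newform
`f` attached to it, and an odd prime `p` of good ordinary reduction such that the cyclotomic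
`p`-adic `L`-function `L_p(f, α_p, T)` vanishes to order at least `4` at `T = 0`.  Hypotheses:
Kato's rank bound (`kato_mordellWeilRank_le_order_padicLFunction`, Astérisque 295 Thm. 18.4) and
the modularity theorem (`exists_isNewformOf`, Breuil–Conrad–Diamond–Taylor) — and NOT
`BirchSwinnertonDyer`; compare `bsd_exists_four_le_analyticRank`, whose complex-analytic
conclusion `∃ E, ord_{s=1} L(E,s) ≥ 4` is not a theorem under any proved hypothesis. -/
theorem kato_exists_four_le_padicOrder
    (hKato : ∀ (W : WeierstrassCurve ℚ) [W.IsElliptic] [W.IsGloballyMinimal] (p : ℕ)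
      [Fact p.Prime] {N : ℕ} [NeZero N] {f : CuspForm (Gamma0 N) 2},
      kato_mordellWeilRank_le_order_padicLFunction W p (f := f))
    (hmod : exists_isNewformOf) :
    ∃ (W : WeierstrassCurve ℚ) (_ : W.IsElliptic) (_ : W.IsGloballyMinimal) (N : ℕ) (_ : NeZero N)
      (f : CuspForm (Gamma0 N) 2) (p : ℕ) (_ : Fact p.Prime),
      IsNewformOf W f ∧ p ≠ 2 ∧ IsOrdinaryAt W p ∧
        (4 : ℕ∞) ≤ (padicLFunction f (unitRoot W p : ℚ_[p])).order := by
  obtain ⟨W, hW⟩ : ∃ W : WeierstrassCurve ℚ, W = ⟨1, -1, 0, -79, 289⟩ := ⟨_, rfl⟩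
  haveI := E4_isElliptic hW
  haveI := E4_isGloballyMinimal hW
  haveI : NeZero (W.conductorNorm ℤ) := ⟨(W.conductorNorm_pos_holds).ne'⟩
  obtain ⟨f, hf⟩ := hmod W
  obtain ⟨p, hp, h2p, hord, h4⟩ := exists_gt_goodOrdinary_four_le_order_E4 hKato hW 2
  exact ⟨W, inferInstance, inferInstance, _, inferInstance, f, p, hp, hf, by omega, hord,
    h4 f hf (by omega)⟩

/-- The same `p`-adic floor over **Kato's divisibility** (Astérisque 295, Thm. 17.4: `X(E/ℚ_∞)` is
`Λ`-torsion and `char_Λ X ∣ p^n L_p(E,T)`; the named fact `kato_divisibility`) instead of Thm.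
18.4: the tree proves 18.4 from 17.4 (`kato_mordellWeilRank_le_order_padicLFunction_of_kato_divisibility`,
with the control theorem, Nakayama and the structure theory of `Λ`-modules all proved there). -/
theorem kato_exists_four_le_padicOrder_of_kato_divisibility
    (hdiv : ∀ (W : WeierstrassCurve ℚ) [W.IsElliptic] [W.IsGloballyMinimal] (p : ℕ)
      [Fact p.Prime] (κ : ZpExtension ℚ p) (γ : Field.absoluteGaloisGroup ℚ) {N : ℕ} [NeZero N]
      {f : CuspForm (Gamma0 N) 2}, kato_divisibility W p (κ := κ) (γ := γ) (f := f))
    (hmod : exists_isNewformOf) :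
    ∃ (W : WeierstrassCurve ℚ) (_ : W.IsElliptic) (_ : W.IsGloballyMinimal) (N : ℕ) (_ : NeZero N)
      (f : CuspForm (Gamma0 N) 2) (p : ℕ) (_ : Fact p.Prime),
      IsNewformOf W f ∧ p ≠ 2 ∧ IsOrdinaryAt W p ∧
        (4 : ℕ∞) ≤ (padicLFunction f (unitRoot W p : ℚ_[p])).order :=
  kato_exists_four_le_padicOrder
    (fun W _ _ p _ _ _ _ =>
      kato_mordellWeilRank_le_order_padicLFunction_of_kato_divisibility W p
        (fun κ γ => hdiv W p κ γ)) hmod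

/-! ### What separates the two floors: one instance of one-sided order transfer -/

/-- **The complex floor from ONE instance of order transfer.**  If at a single odd good ordinary
prime `p` of `E4` and for its newform `f` the one-sided Mazur–Tate–Teitelbaum comparison
`ord_{T=0} L_p(f, α_p, T) ≤ ord_{s=1} L(E4, s)` holds, then — granting Kato 18.4 —
`ord_{s=1} L(E4, s) ≥ 4`, i.e. the existential floor `(∃4)` of rank-BSD is settled.  (The
inequality `ord_T L_p ≤ ord_s L` is known while `ord_T L_p ≤ 2` — interpolation, parity, and in
order one Perrin-Riou's `p`-adic Gross–Zagier formula with Gross–Zagier–Kolyvagin — and open from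
`ord_T L_p = 3` on; here `ord_T L_p ≥ 4`.) -/
theorem four_le_analyticRank_E4_of_orderTransferAt
    (hKato : ∀ (W : WeierstrassCurve ℚ) [W.IsElliptic] [W.IsGloballyMinimal] (p : ℕ)
      [Fact p.Prime] {N : ℕ} [NeZero N] {f : CuspForm (Gamma0 N) 2},
      kato_mordellWeilRank_le_order_padicLFunction W p (f := f))
    (hW : W = ⟨1, -1, 0, -79, 289⟩) (p : ℕ) [Fact p.Prime] (hp : p ≠ 2)
    (hord : haveI := E4_isGloballyMinimal hW; IsOrdinaryAt W p)
    {N : ℕ} [NeZero N] {f : CuspForm (Gamma0 N) 2} (hf : IsNewformOf W f)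
    (hOT : haveI := E4_isGloballyMinimal hW;
      (padicLFunction f (unitRoot W p : ℚ_[p])).order ≤ (W.analyticRank : ℕ∞)) :
    4 ≤ W.analyticRank := by
  have h := (four_le_order_padicLFunction_E4 hKato hW p hp hord hf).trans hOT
  exact_mod_cast h

/-- Hence, granting Kato 18.4, **one instance of one-sided order transfer at `E4` yields the
existential floor `(∃4)`** in the shape of `bsd_exists_four_le_analyticRank`, with the summit
`BirchSwinnertonDyer` replaced by that single `p`-adic-versus-complex inequality. -/
theorem exists_four_le_analyticRank_of_orderTransferAt_E4
    (hKato : ∀ (W : WeierstrassCurve ℚ) [W.IsElliptic] [W.IsGloballyMinimal] (p : ℕ)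
      [Fact p.Prime] {N : ℕ} [NeZero N] {f : CuspForm (Gamma0 N) 2},
      kato_mordellWeilRank_le_order_padicLFunction W p (f := f))
    (hW : W = ⟨1, -1, 0, -79, 289⟩)
    (hOT : haveI := E4_isGloballyMinimal hW;
      ∃ (p : ℕ) (_ : Fact p.Prime) (N : ℕ) (_ : NeZero N) (f : CuspForm (Gamma0 N) 2),
        p ≠ 2 ∧ IsOrdinaryAt W p ∧ IsNewformOf W f ∧
          (padicLFunction f (unitRoot W p : ℚ_[p])).order ≤ (W.analyticRank : ℕ∞)) :
    ∃ V : WeierstrassCurve ℚ, V.IsElliptic ∧ 4 ≤ V.analyticRank := by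
  obtain ⟨p, hp, N, hN, f, hp2, hord, hf, hle⟩ := hOT
  exact ⟨W, E4_isElliptic hW, four_le_analyticRank_E4_of_orderTransferAt hKato hW p hp2 hord hf hle⟩

end Summit.BirchSwinnertonDyer.BirchSwinnertonDyer.Theorems.SoloBlind
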